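import Mathlib
import HarnessLib
import Literature.MathematicalPhysics.KineticTheory.VelocityFlipNoise
import Summits.AtomisticToContinuum.FouriersLaw.Theorems.VanishingNoiseTransferVanishingNoiseBoundFlipDualKuboLink

/-!
# Stub `stub_flipPositiveConductance` of line `sector-dirichlet-gluing`, part 2: the stub from dual forward fields
(crux `VanishingNoiseTransfer.NoisyFourier`, item stmt-AtomisticToContinuum-11977)

Helper file `--supports stmt-AtomisticToContinuum-11977` (route `VanishingNoiseTransfer`, line
`sector-dirichlet-gluing`, stub `stub_flipPositiveConductance`).

ROAD B one step upstream of part 1 (`…FlipPositiveConductanceAux1`,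
`flipPositiveConductance_of_noisyPositiveConductance`): the derivative-free dual forward field hypothesis `FF''(ε)`
of the sister crux `VanishingNoiseBound` (stmt-AtomisticToContinuum-11976) — for all admissible parameters, `T > 0`,
`ε > 0`, every flip-steady family unique in its class and every `L ≥ 2`: a `C²` classical equilibrium forward field
`g 0` of `L_{T,T} + εS` with source `−(p_0² − T)`; `e^{H/4T}`-bounded measurable distributional forward fields
`g δ` of `L_{T+δ/2,T−δ/2} + εS` with source `−(p_0² − T) + μ_δ(p_0² − T)` for `0 < |δ| < δ₀`; continuity at
`δ = 0` along `δ ≠ 0` of the two Gibbs pairings `⟨g δ, p_b² − T⟩_{μ_T}`, `b = 0, L − 1` — is EXACTLY the hypothesis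
of the registered stub `stub_dualKuboRoadLanded` of that crux, whose statement is verbatim the landed theorem
`VanishingNoiseBound.noisyPositiveConductance_of_dualForwardFields` (`…VanishingNoiseBoundFlipDualKuboLink`: energy
balance, the dual Kubo identity, the flip row sum, the Onsager sign). Hence `FF''(ε)` implies stub
`stub_flipPositiveConductance` verbatim; the only reshaping is that uniqueness of flip steady states (`huniq`) and
a flip-steady family (`hμ`) give a family "flip-steady and unique in its class".

* `flipPositiveConductance_of_dualForwardFields` — the implication;
* `helper_flipPositiveConductanceOfDualForwardFields` — registered helper: the per-length form (one instance of `FF''(ε)` at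
  `L ≥ 2` gives `0 < D L`, `VanishingNoiseBound.flip_response_pos_of_dualForwardFields`).

No definitions; axioms `propext`, `Classical.choice`, `Quot.sound` only.
-/

noncomputable section

open MeasureTheory Filter Topology
open scoped ContDiff

namespace Summit.AtomisticToContinuum.FouriersLaw.Theorems.NoisyFourier.FlipPositiveConductance

open Literature.MathematicalPhysics.KineticTheory.HeatConduction

/-- **ROAD B adapter, one step upstream: stub `stub_flipPositiveConductance` from dual forward fields.** The
derivative-free dual forward field hypothesis `FF''(ε)` of crux `VanishingNoiseBound` (see the module docstring)
implies stub `stub_flipPositiveConductance` of line `sector-dirichlet-gluing` verbatim, through the landed dual Kubo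
link `VanishingNoiseBound.noisyPositiveConductance_of_dualForwardFields` fed with the family `μ`, which is unique
in its class by `huniq`. -/
theorem flipPositiveConductance_of_dualForwardFields
    (hFF : ∀ (ω₂ lam β γ T ε : ℝ), 0 < ω₂ → 0 < lam → 0 < β → 0 < γ → 0 < T → 0 < ε → ∀ μ : (N : ℕ) → ℝ → ℝ → MeasureTheory.Measure (Literature.MathematicalPhysics.KineticTheory.HeatConduction.PhaseSpace N), (∀ (N : ℕ) (T_L T_R : ℝ), 0 < T_L → 0 < T_R → (Literature.MathematicalPhysics.KineticTheory.HeatConduction.pinnedChain ω₂ lam β γ).IsFlipSteadyState N T_L T_R ε (μ N T_L T_R) ∧ ∀ ν : MeasureTheory.Measure (Literature.MathematicalPhysics.KineticTheory.HeatConduction.PhaseSpace N), (Literature.MathematicalPhysics.KineticTheory.HeatConduction.pinnedChain ω₂ lam β γ).IsFlipSteadyState N T_L T_R ε ν → ν = μ N T_L T_R) → ∀ (L : ℕ) (hL : 2 ≤ L), ∃ (g : ℝ → Literature.MathematicalPhysics.KineticTheory.HeatConduction.PhaseSpace L → ℝ) (δ₀ : ℝ), 0 < δ₀ ∧ ContDiff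 ℝ 2 (g 0) ∧ (∀ x, (Literature.MathematicalPhysics.KineticTheory.HeatConduction.pinnedChain ω₂ lam β γ).flipGenerator L T T ε (g 0) x = -(Summit.AtomisticToContinuum.FouriersLaw.Theorems.SuperadditiveResistance.DeviceLiouville.kin L 0 x - T)) ∧ (∀ δ, |δ| < δ₀ → ∃ C : ℝ, ∀ x, |g δ x| ≤ C * Real.exp (1 / (4 * T) * (Literature.MathematicalPhysics.KineticTheory.HeatConduction.pinnedChain ω₂ lam β γ).hamiltonian L x)) ∧ (∀ δ, 0 < |δ| → |δ| < δ₀ → Measurable (g δ) ∧ ∀ φ : Literature.MathematicalPhysics.KineticTheory.HeatConduction.PhaseSpace L → ℝ, ContDiff ℝ ((⊤ : ℕ∞) : WithTop ℕ∞) φ → HasCompactSupport φ → ∫ x, g δ x * (-((Literature.MathematicalPhysics.KineticTheory.HeatConduction.pinnedChain ω₂ lam β γ).generator L (T + δ / 2) (T - δ / 2) φ x) + 2 * γ * ((T + δ / 2) * Literature.MathematicalPhysics.KineticTheory.HeatConduction.partialP (⟨0, by omega⟩ : Fin L) (Literature.MathematicalPhysics.KineticTheory.HeatConduction.partialP (⟨0,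 by omega⟩ : Fin L) φ) x + (T - δ / 2) * Literature.MathematicalPhysics.KineticTheory.HeatConduction.partialP (⟨L - 1, by omega⟩ : Fin L) (Literature.MathematicalPhysics.KineticTheory.HeatConduction.partialP (⟨L - 1, by omega⟩ : Fin L) φ) x) + 2 * γ * φ x + ε * Literature.MathematicalPhysics.KineticTheory.HeatConduction.flipNoise L φ x) = ∫ x, (-(Summit.AtomisticToContinuum.FouriersLaw.Theorems.SuperadditiveResistance.DeviceLiouville.kin L 0 x - T) + ∫ y, (Summit.AtomisticToContinuum.FouriersLaw.Theorems.SuperadditiveResistance.DeviceLiouville.kin L 0 y - T) ∂(μ L (T + δ / 2) (T - δ / 2))) * φ x) ∧ Filter.Tendsto (fun δ => ∫ x, g δ x * (Summit.AtomisticToContinuum.FouriersLaw.Theorems.SuperadditiveResistance.DeviceLiouville.kin L 0 x - T) ∂((Literature.MathematicalPhysics.KineticTheory.HeatConduction.pinnedChain ω₂ lam β γ).gibbsMeasure L T)) (nhdsWithin 0 {(0 : ℝ)}ᶜ) (nhds (∫ x, g 0 x * (Summit.AtomisticToContinuum.FouriersLaw.Theorems.SuperadditiveResistance.DeviceLiouville.kin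 L 0 x - T) ∂((Literature.MathematicalPhysics.KineticTheory.HeatConduction.pinnedChain ω₂ lam β γ).gibbsMeasure L T))) ∧ Filter.Tendsto (fun δ => ∫ x, g δ x * (Summit.AtomisticToContinuum.FouriersLaw.Theorems.SuperadditiveResistance.DeviceLiouville.kin L (L - 1) x - T) ∂((Literature.MathematicalPhysics.KineticTheory.HeatConduction.pinnedChain ω₂ lam β γ).gibbsMeasure L T)) (nhdsWithin 0 {(0 : ℝ)}ᶜ) (nhds (∫ x, g 0 x * (Summit.AtomisticToContinuum.FouriersLaw.Theorems.SuperadditiveResistance.DeviceLiouville.kin L (L - 1) x - T) ∂((Literature.MathematicalPhysics.KineticTheory.HeatConduction.pinnedChain ω₂ lam β γ).gibbsMeasure L T)))) :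
    ∀ ω₂ lam β γ : ℝ, 0 < ω₂ → 0 < lam → 0 < β → 0 < γ → ∀ ε : ℝ, 0 < ε → (∀ (N : ℕ) (T_L T_R : ℝ), 0 < T_L → 0 < T_R → ∀ μ ν : MeasureTheory.Measure (Literature.MathematicalPhysics.KineticTheory.HeatConduction.PhaseSpace N), (Literature.MathematicalPhysics.KineticTheory.HeatConduction.pinnedChain ω₂ lam β γ).IsFlipSteadyState N T_L T_R ε μ → (Literature.MathematicalPhysics.KineticTheory.HeatConduction.pinnedChain ω₂ lam β γ).IsFlipSteadyState N T_L T_R ε ν → μ = ν) → ∀ μ : (N : ℕ) → ℝ → ℝ → MeasureTheory.Measure (Literature.MathematicalPhysics.KineticTheory.HeatConduction.PhaseSpace N), (∀ (N : ℕ) (T_L T_R : ℝ), 0 < T_L → 0 < T_R → (Literature.MathematicalPhysics.KineticTheory.HeatConduction.pinnedChain ω₂ lam β γ).IsFlipSteadyState N T_L T_R ε (μ N T_L T_R)) → ∀ T : ℝ, 0 < T → ∀ D : ℕ → ℝ, (∀ N : ℕ, Filter.Tendsto (fun δ : ℝ => (Literature.MathematicalPhysics.KineticTheory.HeatConduction.pinnedChain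 ω₂ lam β γ).totalCurrent (μ N (T + δ / 2) (T - δ / 2)) / δ) (nhdsWithin 0 {(0 : ℝ)}ᶜ) (nhds (D N))) → ∀ N : ℕ, 2 ≤ N → 0 < D N :=
  fun ω₂ lam β γ hω hl hβ hγ ε hε huniq μ hμ T hT D hD N hN =>
    VanishingNoiseBound.noisyPositiveConductance_of_dualForwardFields hFF ω₂ lam β γ hω hl hβ hγ T hT ε hε μ
      (fun N T_L T_R hL hR =>
        ⟨hμ N T_L T_R hL hR, fun ν hν => huniq N T_L T_R hL hR ν (μ N T_L T_R) hν (hμ N T_L T_R hL hR)⟩)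
      D hD N hN

/-! ## Registered helper -/

/-- Registered helper sub-goal `helper_flipPositiveConductanceOfDualForwardFields` of stub
`stub_flipPositiveConductance` (line `sector-dirichlet-gluing`, crux stmt-AtomisticToContinuum-11977): ROAD B per
length `L ≥ 2` — under uniqueness of flip steady states, along a flip-steady family, ONE instance of the dual forward
field hypothesis `FF''(ε)` at `L` (a `C²` classical equilibrium forward field `g 0`, `e^{H/4T}`-bounded measurable
distributional forward fields `g δ` with the flip-family centring constants for `0 < |δ| < δ₀`, the two Gibbs-pairing
limits) gives `0 < D L` for the response coefficient `D L` at `T`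
(`VanishingNoiseBound.flip_response_pos_of_dualForwardFields`). -/
theorem helper_flipPositiveConductanceOfDualForwardFields : ∀ (ω₂ lam β γ ε T : ℝ) (μ : (N : ℕ) → ℝ → ℝ → MeasureTheory.Measure (Literature.MathematicalPhysics.KineticTheory.HeatConduction.PhaseSpace N)) (D : ℕ → ℝ), 0 < ω₂ → 0 < lam → 0 < β → 0 < γ → 0 < ε → 0 < T → (∀ (N : ℕ) (T_L T_R : ℝ), 0 < T_L → 0 < T_R → ∀ μ ν : MeasureTheory.Measure (Literature.MathematicalPhysics.KineticTheory.HeatConduction.PhaseSpace N), (Literature.MathematicalPhysics.KineticTheory.HeatConduction.pinnedChain ω₂ lam β γ).IsFlipSteadyState N T_L T_R ε μ → (Literature.MathematicalPhysics.KineticTheory.HeatConduction.pinnedChain ω₂ lam β γ).IsFlipSteadyState N T_L T_R ε ν → μ = ν) → (∀ (N : ℕ) (T_L T_R : ℝ), 0 < T_L → 0 < T_R → (Literature.MathematicalPhysics.KineticTheory.HeatConduction.pinnedChain ω₂ lam β γ).IsFlipSteadyState N T_L T_R ε (μ N T_L T_R)) → ∀ (L : ℕ) (hL : 2 ≤ L),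 Filter.Tendsto (fun δ : ℝ => (Literature.MathematicalPhysics.KineticTheory.HeatConduction.pinnedChain ω₂ lam β γ).totalCurrent (μ L (T + δ / 2) (T - δ / 2)) / δ) (nhdsWithin 0 {(0 : ℝ)}ᶜ) (nhds (D L)) → ∀ (g : ℝ → Literature.MathematicalPhysics.KineticTheory.HeatConduction.PhaseSpace L → ℝ) (δ₀ : ℝ), 0 < δ₀ → ContDiff ℝ 2 (g 0) → (∀ x, (Literature.MathematicalPhysics.KineticTheory.HeatConduction.pinnedChain ω₂ lam β γ).flipGenerator L T T ε (g 0) x = -(Summit.AtomisticToContinuum.FouriersLaw.Theorems.SuperadditiveResistance.DeviceLiouville.kin L 0 x - T)) → (∀ δ, |δ| < δ₀ → ∃ C : ℝ, ∀ x, |g δ x| ≤ C * Real.exp (1 / (4 * T) * (Literature.MathematicalPhysics.KineticTheory.HeatConduction.pinnedChain ω₂ lam β γ).hamiltonian L x)) → (∀ δ, 0 < |δ| → |δ| < δ₀ → Measurable (g δ) ∧ ∀ φ : Literature.MathematicalPhysics.KineticTheory.HeatConduction.PhaseSpace L → ℝ, ContDiff ℝ ((⊤ : ℕ∞) : WithTop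 ℕ∞) φ → HasCompactSupport φ → ∫ x, g δ x * (-((Literature.MathematicalPhysics.KineticTheory.HeatConduction.pinnedChain ω₂ lam β γ).generator L (T + δ / 2) (T - δ / 2) φ x) + 2 * γ * ((T + δ / 2) * Literature.MathematicalPhysics.KineticTheory.HeatConduction.partialP (⟨0, by omega⟩ : Fin L) (Literature.MathematicalPhysics.KineticTheory.HeatConduction.partialP (⟨0, by omega⟩ : Fin L) φ) x + (T - δ / 2) * Literature.MathematicalPhysics.KineticTheory.HeatConduction.partialP (⟨L - 1, by omega⟩ : Fin L) (Literature.MathematicalPhysics.KineticTheory.HeatConduction.partialP (⟨L - 1, by omega⟩ : Fin L) φ) x) + 2 * γ * φ x + ε * Literature.MathematicalPhysics.KineticTheory.HeatConduction.flipNoise L φ x) = ∫ x, (-(Summit.AtomisticToContinuum.FouriersLaw.Theorems.SuperadditiveResistance.DeviceLiouville.kin L 0 x - T) + ∫ y, (Summit.AtomisticToContinuum.FouriersLaw.Theorems.SuperadditiveResistance.DeviceLiouville.kin L 0 y - T) ∂(μ L (T + δ / 2) (T - δ / 2))) * φ x) → Filter.Tendsto (fun δ => ∫ x, g δ x * (Summit.AtomisticToContinuum.FouriersLaw.Theorems.SuperadditiveResistance.DeviceLiouville.kin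 L 0 x - T) ∂((Literature.MathematicalPhysics.KineticTheory.HeatConduction.pinnedChain ω₂ lam β γ).gibbsMeasure L T)) (nhdsWithin 0 {(0 : ℝ)}ᶜ) (nhds (∫ x, g 0 x * (Summit.AtomisticToContinuum.FouriersLaw.Theorems.SuperadditiveResistance.DeviceLiouville.kin L 0 x - T) ∂((Literature.MathematicalPhysics.KineticTheory.HeatConduction.pinnedChain ω₂ lam β γ).gibbsMeasure L T))) → Filter.Tendsto (fun δ => ∫ x, g δ x * (Summit.AtomisticToContinuum.FouriersLaw.Theorems.SuperadditiveResistance.DeviceLiouville.kin L (L - 1) x - T) ∂((Literature.MathematicalPhysics.KineticTheory.HeatConduction.pinnedChain ω₂ lam β γ).gibbsMeasure L T)) (nhdsWithin 0 {(0 : ℝ)}ᶜ) (nhds (∫ x, g 0 x * (Summit.AtomisticToContinuum.FouriersLaw.Theorems.SuperadditiveResistance.DeviceLiouville.kin L (L - 1) x - T) ∂((Literature.MathematicalPhysics.KineticTheory.HeatConduction.pinnedChain ω₂ lam β γ).gibbsMeasure L T))) → 0 < D L :=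
  fun _ _ _ _ _ _ μ D hω hl hβ hγ hε hT huniq hμ _ hL hD g _ hδ₀ hC hpde hbd hweak hlim0 hlim1 => by
    obtain ⟨C₀, hgb0⟩ := hbd 0 (by simpa using hδ₀)
    exact VanishingNoiseBound.flip_response_pos_of_dualForwardFields μ D hω hl hβ hγ hT hε
      (fun N T_L T_R hL' hR' =>
        ⟨hμ N T_L T_R hL' hR', fun ν hν => huniq N T_L T_R hL' hR' ν (μ N T_L T_R) hν (hμ N T_L T_R hL' hR')⟩)
      hL hD g hδ₀ (fun δ h0 h1 => ((hweak δ h0 h1).1).aestronglyMeasurable) (fun δ _ h1 => hbd δ h1)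
      (fun δ h0 h1 => (hweak δ h0 h1).2) hlim0 hlim1 hC hgb0 hpde

end Summit.AtomisticToContinuum.FouriersLaw.Theorems.NoisyFourier.FlipPositiveConductance

end
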